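import Mathlib.Analysis.SpecialFunctions.Trigonometric.Complex
import Mathlib.Data.Int.Interval
import Mathlib.Data.Set.Card
import HarnessLib

/-!
# Counting the crossings of the levels `π/2 + kπ` by a phase with jumps

Trunk T-ANALYSIS support (`Literature/Analysis/Complex`). The real-variable counting step of
Levinson's method in Conrey's arrangement (J. B. Conrey, *J. Number Theory* 16 (1983), §4, the
sentence after (1): "`ξ(½+it) = 0` precisely when (a) `arg Q(½+it) ≡ π/2 (mod π)` or (b)
`Q(½+it) = 0` … If `½ + it₁` is a zero of `Q` of multiplicity `n` we define
`arg Q(½ + it₁⁺) = arg Q(½ + it₁⁻) + nπ` … Hence `N₀(T+U) − N₀(T) ≥ (1/π)(arg Q(½+i(T+U)) − arg Q(½+iT)) − 1`").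

Abstractly: a *phase with jumps* on `[T₁, T₂]` is `Φ(t) = Φc(t) + π Σ_{s ∈ S, s < t} n(s)` with `Φc`
continuous on `[T₁, T₂]`, `S ⊆ (T₁, T₂)` finite and `n(s) ∈ ℕ`. The *levels* are the odd multiples
`π/2 + kπ` of `π/2`. We prove (`exists_finset_cos_jumpPhase_eq_zero`): there is a finite set
`F ⊆ (T₁, T₂) ∖ S` of points at which `cos Φ = 0` (level crossings in the continuity intervals)
such that

  `(Φ(T₂) − Φ(T₁))/π − 1 ≤ #F + Σ_{s ∈ S} (n(s) + [cos Φ(s⁻) = 0])`,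

where `Φ(s⁻) = Φc(s) + π Σ_{x < s} n(x)` is the left value at the jump and `[·]` is `1` or `0`. The
bracket records the only subtlety glossed over in the printed argument: a jump of `nπ` covers
`n` levels when its end values are not levels, but `n + 1` when they are — and in Levinson's
method that case is exactly the one in which the zero of `ξ` at the jump point has multiplicity
`≥ n + 1` (the user of this lemma supplies multiplicity `n(s)`, resp. `n(s) + 1`, at `s ∈ S`, and
multiplicity `≥ 1` at the points of `F`).

Proof: the number of levels strictly between `Φ(T₁)` and `Φ(T₂)` is at least
`(Φ(T₂) − Φ(T₁))/π − 1` (`sub_div_pi_sub_one_le_ncard`); by induction on `S` (removing the largest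
jump point) every such level is either crossed inside a continuity interval (intermediate value
theorem; distinct levels give distinct points) or lies in the closed range of a jump, which
contains at most `n + [cos Φ(s⁻) = 0]` levels (`ncard_level_mem_Icc_le`).

## Main results

* `finite_setOf_level_mem_Ioo`, `sub_div_pi_sub_one_le_ncard`, `ncard_level_mem_Icc_le` —
  counting the levels `π/2 + kπ` in open and closed intervals.
* `exists_finset_cos_eq_zero_of_continuousOn` — the continuous case (no jumps).
* `exists_finset_cos_jumpPhase_eq_zero_aux` (induction form),
  `exists_finset_cos_jumpPhase_eq_zero` — the statement displayed above.

## References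

* J. B. Conrey, *Zeros of derivatives of Riemann's ξ-function on the critical line*, J. Number
  Theory 16 (1983), 49–74, §4.
* N. Levinson, *More than one third of zeros of Riemann's zeta-function are on `σ = 1/2`*,
  Adv. Math. 13 (1974), 383–436, §1–2.
-/

noncomputable section

open Set Real

namespace Literature.Analysis.Complex

/-! ## Counting the levels `π/2 + kπ` -/

/-- The levels `π/2 + kπ` lying in a bounded open interval are indexed by a finite set of
integers. [folklore] -/
theorem finite_setOf_level_mem_Ioo (α β : ℝ) :
    {k : ℤ | α < π / 2 + k * π ∧ π / 2 + k * π < β}.Finite := by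
  refine (Set.finite_Icc ⌊(α - π / 2) / π⌋ ⌈(β - π / 2) / π⌉).subset ?_
  rintro k ⟨h1, h2⟩
  have hπ := Real.pi_pos
  constructor
  · have : (α - π / 2) / π < k := by rw [div_lt_iff₀ hπ]; linarith
    exact Int.floor_le_iff.2 (by linarith)
  · have : (k : ℝ) < (β - π / 2) / π := by rw [lt_div_iff₀ hπ]; linarith
    exact Int.cast_le.1 (this.le.trans (Int.le_ceil _))

/-- **At least `(β − α)/π − 1` levels** `π/2 + kπ` lie strictly between `α` and `β`. [folklore] -/
theorem sub_div_pi_sub_one_le_ncard (α β : ℝ) :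
    (β - α) / π - 1 ≤ ({k : ℤ | α < π / 2 + k * π ∧ π / 2 + k * π < β}.ncard : ℝ) := by
  have hπ := Real.pi_pos
  set u : ℝ := (α - π / 2) / π with hu
  set v : ℝ := (β - π / 2) / π with hv
  have hsub : (↑(Finset.Ioo ⌊u⌋ ⌈v⌉) : Set ℤ) ⊆ {k : ℤ | α < π / 2 + k * π ∧ π / 2 + k * π < β} := by
    intro k hk
    rw [Finset.coe_Ioo, Set.mem_Ioo] at hk
    obtain ⟨hk1, hk2⟩ := hk
    have hk1' : u < k := by
      have : (⌊u⌋ : ℝ) + 1 ≤ k := by exact_mod_cast hk1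
      linarith [Int.lt_floor_add_one u]
    have hk2' : (k : ℝ) < v := by
      have : (k : ℝ) + 1 ≤ ⌈v⌉ := by exact_mod_cast hk2
      linarith [Int.ceil_lt_add_one v]
    rw [hu, div_lt_iff₀ hπ] at hk1'
    rw [hv, lt_div_iff₀ hπ] at hk2'
    exact ⟨by linarith, by linarith⟩
  have hfin := finite_setOf_level_mem_Ioo α β
  have hcard := Set.ncard_le_ncard hsub hfin
  rw [Set.ncard_coe_finset, Int.card_Ioo] at hcard
  have h1 : v - u - 1 ≤ ((⌈v⌉ - ⌊u⌋ - 1 : ℤ) : ℝ) := by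
    push_cast
    linarith [Int.floor_le u, Int.le_ceil v]
  have h2 : ((⌈v⌉ - ⌊u⌋ - 1 : ℤ) : ℝ) ≤ ((⌈v⌉ - ⌊u⌋ - 1).toNat : ℝ) := by
    exact_mod_cast Int.self_le_toNat _
  have h3 : ((⌈v⌉ - ⌊u⌋ - 1).toNat : ℝ) ≤
      ({k : ℤ | α < π / 2 + k * π ∧ π / 2 + k * π < β}.ncard : ℝ) := by
    exact_mod_cast hcard
  have e : (β - α) / π - 1 = v - u - 1 := by
    rw [hu, hv]
    field_simp
    ring
  linarith

/-- **A closed interval of length `nπ` contains at most `n` levels `π/2 + kπ`, or `n + 1` when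
its endpoints are levels** (`cos x = 0`). [folklore] -/
theorem ncard_level_mem_Icc_le (x : ℝ) (n : ℕ) :
    {k : ℤ | x ≤ π / 2 + k * π ∧ π / 2 + k * π ≤ x + n * π}.ncard ≤
      n + if Real.cos x = 0 then 1 else 0 := by
  have hπ := Real.pi_pos
  set u : ℝ := (x - π / 2) / π with hu
  have hsub : {k : ℤ | x ≤ π / 2 + k * π ∧ π / 2 + k * π ≤ x + n * π} ⊆
      ↑(Finset.Icc ⌈u⌉ (⌊u⌋ + n)) := by
    rintro k ⟨h1, h2⟩
    rw [Finset.coe_Icc, Set.mem_Icc]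
    have hk1 : u ≤ k := by rw [hu, div_le_iff₀ hπ]; linarith
    have hk2 : (k : ℝ) ≤ u + n := by rw [hu, div_add' _ _ _ hπ.ne', le_div_iff₀ hπ]; linarith
    refine ⟨Int.ceil_le.2 hk1, ?_⟩
    have : k ≤ ⌊u + n⌋ := Int.le_floor.2 (by exact_mod_cast hk2)
    rwa [Int.floor_add_natCast] at this
  have hcard := Set.ncard_le_ncard hsub (Finset.finite_toSet _)
  rw [Set.ncard_coe_finset, Int.card_Icc] at hcard
  refine hcard.trans ?_
  rw [Int.toNat_le]
  by_cases hc : Real.cos x = 0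
  · rw [if_pos hc]
    push_cast
    linarith [Int.floor_le_ceil u]
  · rw [if_neg hc]
    push_cast
    -- `u` is not an integer, so `⌊u⌋ + 1 ≤ ⌈u⌉`
    have hlt : ⌊u⌋ < ⌈u⌉ := by
      by_contra h
      push Not at h
      have h1 : (⌈u⌉ : ℝ) ≤ ⌊u⌋ := by exact_mod_cast h
      have hu_eq : u = ⌊u⌋ := le_antisymm ((Int.le_ceil u).trans h1) (Int.floor_le u)
      apply hc
      rw [Real.cos_eq_zero_iff]
      refine ⟨⌊u⌋, ?_⟩
      have : x = π / 2 + u * π := by rw [hu]; field_simp; ring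
      rw [this, hu_eq]
      simp only [Int.floor_intCast]
      ring
    linarith

/-! ## The continuous case -/

/-- **Level crossings of a continuous phase.** If `Ψ` is continuous on `[T₁, T₂]`, there is a
finite set `F ⊆ (T₁, T₂)` of points with `cos Ψ = 0`, one for each level `π/2 + kπ` strictly
between `Ψ(T₁)` and `Ψ(T₂)` (intermediate value theorem; distinct levels, distinct points).
[folklore] -/
theorem exists_finset_cos_eq_zero_of_continuousOn {Ψ : ℝ → ℝ} {T₁ T₂ : ℝ} (hT : T₁ ≤ T₂)
    (hΨ : ContinuousOn Ψ (Icc T₁ T₂)) :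
    ∃ F : Finset ℝ, (↑F : Set ℝ) ⊆ Ioo T₁ T₂ ∧ (∀ t ∈ F, Real.cos (Ψ t) = 0) ∧
      {k : ℤ | Ψ T₁ < π / 2 + k * π ∧ π / 2 + k * π < Ψ T₂}.ncard ≤ F.card := by
  classical
  set L : Set ℤ := {k : ℤ | Ψ T₁ < π / 2 + k * π ∧ π / 2 + k * π < Ψ T₂} with hL
  have hfin : L.Finite := finite_setOf_level_mem_Ioo _ _
  have hIVT := intermediate_value_Ioo hT hΨ
  have hex : ∀ k ∈ L, ∃ t ∈ Ioo T₁ T₂, Ψ t = π / 2 + k * π := by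
    intro k hk
    obtain ⟨t, ht, hte⟩ := hIVT ⟨hk.1, hk.2⟩
    exact ⟨t, ht, hte⟩
  choose! g hg using hex
  refine ⟨hfin.toFinset.image g, ?_, ?_, ?_⟩
  · intro t ht
    rw [Finset.coe_image] at ht
    obtain ⟨k, hk, rfl⟩ := ht
    exact (hg k (hfin.mem_toFinset.1 hk)).1
  · intro t ht
    rw [Finset.mem_image] at ht
    obtain ⟨k, hk, rfl⟩ := ht
    rw [(hg k (hfin.mem_toFinset.1 hk)).2, Real.cos_eq_zero_iff]
    exact ⟨k, by ring⟩
  · rw [Set.ncard_eq_toFinset_card _ hfin, Finset.card_image_of_injOn]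
    intro k hk k' hk' hkk'
    have h1 := (hg k (hfin.mem_toFinset.1 hk)).2
    have h2 := (hg k' (hfin.mem_toFinset.1 hk')).2
    have h : (π / 2 + k * π : ℝ) = π / 2 + k' * π := by rw [← h1, ← h2]; exact congrArg Ψ hkk'
    have hπ := Real.pi_pos
    have : (k : ℝ) = k' := by
      have : ((k : ℝ) - k') * π = 0 := by linarith
      rcases mul_eq_zero.1 this with h0 | h0
      · linarith
      · exact absurd h0 hπ.ne'
    exact_mod_cast this

/-! ## Phases with jumps -/

/-- **Level crossings of a phase with jumps** (induction form). For `S` a finite set of jump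
points, all `T₁ < T₂`, `Φc` continuous on `[T₁, T₂]`, `S ⊆ (T₁, T₂)` and weights `n : ℝ → ℕ`,
with the phase `Φ(t) = Φc(t) + π Σ_{s ∈ S, s < t} n(s)`: there is a finite `F ⊆ (T₁, T₂)` disjoint
from `S` with `cos Φ = 0` on `F` and
`#{k : Φ(T₁) < π/2 + kπ < Φ(T₂)} ≤ #F + Σ_{s ∈ S} (n(s) + [cos Φ(s⁻) = 0])`
(`Φ(T₁) = Φc(T₁)`, `Φ(T₂) = Φc(T₂) + π Σ_{s ∈ S} n(s)`, `Φ(s⁻) = Φc(s) + π Σ_{x ∈ S, x < s} n(x)`).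
[cite: Conrey1983, §4 (after (1))] -/
theorem exists_finset_cos_jumpPhase_eq_zero_aux (S : Finset ℝ) :
    ∀ (T₁ T₂ : ℝ) (Φc : ℝ → ℝ) (n : ℝ → ℕ), T₁ < T₂ → ContinuousOn Φc (Icc T₁ T₂) →
      (↑S : Set ℝ) ⊆ Ioo T₁ T₂ →
      ∃ F : Finset ℝ, (↑F : Set ℝ) ⊆ Ioo T₁ T₂ ∧ Disjoint F S ∧
        (∀ t ∈ F, Real.cos (Φc t + π * ∑ s ∈ S.filter (· < t), (n s : ℝ)) = 0) ∧
        ({k : ℤ | Φc T₁ < π / 2 + k * π ∧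
            π / 2 + k * π < Φc T₂ + π * ∑ s ∈ S, (n s : ℝ)}.ncard : ℝ) ≤
          F.card + ∑ s ∈ S, ((n s : ℝ) +
            if Real.cos (Φc s + π * ∑ x ∈ S.filter (· < s), (n x : ℝ)) = 0 then 1 else 0) := by
  classical
  induction S using Finset.induction_on_max with
  | empty =>
    intro T₁ T₂ Φc n hT hΦ _
    obtain ⟨F, hFsub, hFcos, hFcnt⟩ := exists_finset_cos_eq_zero_of_continuousOn hT.le hΦ
    refine ⟨F, hFsub, Finset.disjoint_empty_right _, fun t ht ↦ by simpa using hFcos t ht, ?_⟩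
    simp only [Finset.sum_empty, mul_zero, add_zero]
    exact_mod_cast hFcnt
  | insert s S' hlt ih =>
    intro T₁ T₂ Φc n hT hΦ hS
    have hs : s ∈ Ioo T₁ T₂ := hS (Finset.mem_coe.2 (Finset.mem_insert_self s S'))
    have hsS' : s ∉ S' := fun h ↦ lt_irrefl s (hlt s h)
    have hS' : (↑S' : Set ℝ) ⊆ Ioo T₁ s := fun x hx ↦
      ⟨(hS (Finset.mem_coe.2 (Finset.mem_insert_of_mem hx))).1, hlt x hx⟩
    -- the jump sums before and after `s`
    have hfilt_le : ∀ t : ℝ, t ≤ s → (insert s S').filter (· < t) = S'.filter (· < t) := by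
      intro t ht
      rw [Finset.filter_insert, if_neg (not_lt.2 ht)]
    have hfilt_gt : ∀ t : ℝ, s < t → (insert s S').filter (· < t) = insert s S' := by
      intro t ht
      refine Finset.filter_true_of_mem fun x hx ↦ ?_
      rw [Finset.mem_insert] at hx
      rcases hx with rfl | hx
      · exact ht
      · exact (hlt x hx).trans ht
    have hfilt_S' : S'.filter (· < s) = S' := Finset.filter_true_of_mem fun x hx ↦ hlt x hx
    -- the induction hypothesis on `[T₁, s]`
    obtain ⟨F', hF'sub, hF'disj, hF'cos, hF'cnt⟩ :=
      ih T₁ s Φc n hs.1 (hΦ.mono (Icc_subset_Icc le_rfl hs.2.le)) hS'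
    -- the continuous piece `[s, T₂]`
    set β : ℝ := Φc s + π * ∑ x ∈ S', (n x : ℝ) with hβ
    set C : ℝ := π * (∑ x ∈ S', (n x : ℝ) + n s) with hC
    obtain ⟨F'', hF''sub, hF''cos, hF''cnt⟩ := exists_finset_cos_eq_zero_of_continuousOn
      (Ψ := fun t ↦ Φc t + C) hs.2.le ((hΦ.mono (Icc_subset_Icc hs.1.le le_rfl)).add continuousOn_const)
    -- the jump at `s`
    have hJ := ncard_level_mem_Icc_le β (n s)
    refine ⟨F' ∪ F'', ?_, ?_, ?_, ?_⟩
    · intro t ht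
      rw [Finset.coe_union] at ht
      rcases ht with ht | ht
      · exact ⟨(hF'sub ht).1, (hF'sub ht).2.trans hs.2⟩
      · exact ⟨hs.1.trans (hF''sub ht).1, (hF''sub ht).2⟩
    · rw [Finset.disjoint_left]
      intro t ht htS
      rw [Finset.mem_union] at ht
      rw [Finset.mem_insert] at htS
      rcases ht with ht | ht
      · have ht' := hF'sub (Finset.mem_coe.2 ht)
        rcases htS with rfl | htS
        · exact lt_irrefl _ ht'.2
        · exact Finset.disjoint_left.1 hF'disj ht htS
      · have ht' := hF''sub (Finset.mem_coe.2 ht)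
        rcases htS with rfl | htS
        · exact lt_irrefl _ ht'.1
        · exact lt_asymm ht'.1 (hlt t htS)
    · intro t ht
      rw [Finset.mem_union] at ht
      rcases ht with ht | ht
      · have ht' := hF'sub (Finset.mem_coe.2 ht)
        rw [hfilt_le t ht'.2.le]
        exact hF'cos t ht
      · have ht' := hF''sub (Finset.mem_coe.2 ht)
        rw [hfilt_gt t ht'.1, Finset.sum_insert hsS']
        have h := hF''cos t ht
        convert h using 2
        rw [hC]
        ring
    · -- the count: every level between `Φ(T₁)` and `Φ(T₂)` is crossed on `[T₁, s]`, jumped at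
      -- `s`, or crossed on `[s, T₂]`
      set L : Set ℤ := {k : ℤ | Φc T₁ < π / 2 + k * π ∧
        π / 2 + k * π < Φc T₂ + π * ∑ x ∈ insert s S', (n x : ℝ)} with hL
      set L₁ : Set ℤ := {k : ℤ | Φc T₁ < π / 2 + k * π ∧ π / 2 + k * π < β} with hL₁
      set LJ : Set ℤ := {k : ℤ | β ≤ π / 2 + k * π ∧ π / 2 + k * π ≤ β + (n s) * π} with hLJ
      set L₂ : Set ℤ := {k : ℤ | Φc s + C < π / 2 + k * π ∧ π / 2 + k * π < Φc T₂ + C} with hL₂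
      have hγ : Φc T₂ + π * ∑ x ∈ insert s S', (n x : ℝ) = Φc T₂ + C := by
        rw [Finset.sum_insert hsS', hC]; ring
      have hβ' : β + (n s) * π = Φc s + C := by rw [hβ, hC]; ring
      have hπ := Real.pi_pos
      have hcover : L ⊆ L₁ ∪ LJ ∪ L₂ := by
        intro k hk
        rw [hL, mem_setOf_eq, hγ] at hk
        obtain ⟨hk1, hk2⟩ := hk
        by_cases h1 : π / 2 + k * π < β
        · exact Or.inl (Or.inl ⟨hk1, h1⟩)
        · by_cases h2 : π / 2 + k * π ≤ β + (n s) * π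
          · exact Or.inl (Or.inr ⟨not_lt.1 h1, h2⟩)
          · refine Or.inr ⟨?_, hk2⟩
            rw [← hβ']
            exact not_le.1 h2
      have hfin₁ : L₁.Finite := finite_setOf_level_mem_Ioo _ _
      have hfin₂ : L₂.Finite := finite_setOf_level_mem_Ioo _ _
      have hfinJ : LJ.Finite := by
        refine (finite_setOf_level_mem_Ioo (β - 1) (β + (n s) * π + 1)).subset ?_
        rintro k ⟨h1, h2⟩
        exact ⟨by linarith, by linarith⟩
      have hcount : L.ncard ≤ L₁.ncard + LJ.ncard + L₂.ncard :=
        calc L.ncard ≤ (L₁ ∪ LJ ∪ L₂).ncard :=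
              Set.ncard_le_ncard hcover ((hfin₁.union hfinJ).union hfin₂)
          _ ≤ (L₁ ∪ LJ).ncard + L₂.ncard := Set.ncard_union_le _ _
          _ ≤ L₁.ncard + LJ.ncard + L₂.ncard := by
              have := Set.ncard_union_le L₁ LJ
              omega
      have hcount' : (L.ncard : ℝ) ≤ L₁.ncard + LJ.ncard + L₂.ncard := by exact_mod_cast hcount
      have hJ' : (LJ.ncard : ℝ) ≤ n s + if Real.cos β = 0 then 1 else 0 := by
        have h := hJ
        have e : ((n s + if Real.cos β = 0 then 1 else 0 : ℕ) : ℝ) =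
            n s + if Real.cos β = 0 then 1 else 0 := by push_cast; rfl
        rw [← e]
        exact_mod_cast h
      have h2' : (L₂.ncard : ℝ) ≤ F''.card := by exact_mod_cast hF''cnt
      -- cardinality of the union and the sum over `insert s S'`
      have hdisjF : Disjoint F' F'' := by
        rw [Finset.disjoint_left]
        intro t ht ht'
        exact lt_asymm (hF'sub (Finset.mem_coe.2 ht)).2 (hF''sub (Finset.mem_coe.2 ht')).1
      have hsum : ∑ x ∈ S', ((n x : ℝ) +
            if Real.cos (Φc x + π * ∑ y ∈ (insert s S').filter (· < x), (n y : ℝ)) = 0 then 1 else 0) =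
          ∑ x ∈ S', ((n x : ℝ) +
            if Real.cos (Φc x + π * ∑ y ∈ S'.filter (· < x), (n y : ℝ)) = 0 then 1 else 0) :=
        Finset.sum_congr rfl fun x hx ↦ by rw [hfilt_le x (hlt x hx).le]
      rw [Finset.card_union_of_disjoint hdisjF, Finset.sum_insert hsS', hfilt_le s le_rfl, hfilt_S',
        hsum]
      push_cast
      have hβcos : (if Real.cos (Φc s + π * ∑ x ∈ S', (n x : ℝ)) = 0 then (1 : ℝ) else 0) =
          if Real.cos β = 0 then 1 else 0 := by rw [hβ]
      rw [hβcos]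
      linarith [hF'cnt, hJ', h2', hcount']

/-- **Level crossings of a phase with jumps.** Let `Φc` be continuous on `[T₁, T₂]` (`T₁ < T₂`),
`S ⊆ (T₁, T₂)` finite, `n : ℝ → ℕ`, and `Φ(t) = Φc(t) + π Σ_{s ∈ S, s < t} n(s)`. Then there is a
finite set `F ⊆ (T₁, T₂)`, disjoint from `S`, of points with `cos Φ = 0`, such that
`(Φ(T₂) − Φ(T₁))/π − 1 ≤ #F + Σ_{s ∈ S} (n(s) + [cos Φ(s⁻) = 0])`, where
`Φ(T₂) − Φ(T₁) = Φc(T₂) − Φc(T₁) + π Σ_{s ∈ S} n(s)` and `Φ(s⁻) = Φc(s) + π Σ_{x < s} n(x)`.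
In Levinson's method `Φ` is the argument of Conrey's `Q(½ + it)` continued with jumps `+nπ` at its
zeros of multiplicity `n`; the points of `F` are zeros of `Re Q`, hence of `ξ`, and the bracket
flags the jumps at which `ξ` vanishes to order `≥ n + 1`. [cite: Conrey1983, §4 (after (1))] -/
theorem exists_finset_cos_jumpPhase_eq_zero {Φc : ℝ → ℝ} {T₁ T₂ : ℝ} (hT : T₁ < T₂)
    (hΦ : ContinuousOn Φc (Icc T₁ T₂)) {S : Finset ℝ} (hS : (↑S : Set ℝ) ⊆ Ioo T₁ T₂)
    (n : ℝ → ℕ) :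
    ∃ F : Finset ℝ, (↑F : Set ℝ) ⊆ Ioo T₁ T₂ ∧ Disjoint F S ∧
      (∀ t ∈ F, Real.cos (Φc t + π * ∑ s ∈ S.filter (· < t), (n s : ℝ)) = 0) ∧
      (Φc T₂ + π * ∑ s ∈ S, (n s : ℝ) - Φc T₁) / π - 1 ≤
        F.card + ∑ s ∈ S, ((n s : ℝ) +
          if Real.cos (Φc s + π * ∑ x ∈ S.filter (· < s), (n x : ℝ)) = 0 then 1 else 0) := by
  obtain ⟨F, hFsub, hFdisj, hFcos, hFcnt⟩ :=
    exists_finset_cos_jumpPhase_eq_zero_aux S T₁ T₂ Φc n hT hΦ hS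
  refine ⟨F, hFsub, hFdisj, hFcos, ?_⟩
  exact (sub_div_pi_sub_one_le_ncard _ _).trans hFcnt

end Literature.Analysis.Complex

end
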